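import Mathlib
import HarnessLib
import Summits.HubbardSuperconductivity.HubbardSuperconductivity.Theses.KLProgramme
import Summits.HubbardSuperconductivity.HubbardSuperconductivity.Theorems.KLProgrammeKLRegimeVolumeLimitExDefs

/-!
# Route `KLProgramme` — crux K3 gen 4, child 4 `KLRegimeTwoPointAssemblyV12 := TwoPointAssemblyP3 klPredsV12 FinalTwoLegVolLimitEx klWindowC` (stmt-HubbardSuperconductivity-19859, route rev 15) — CLOSED

Cell gate-hubbard-kl, seat hubbard-kl-k3c5-p1 (row (b) child TwoPointAssembly; gen-2/3 twins `…TwoPointAssemblyV7`/`…V11Closes`).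
With the ∃-threshold volume-limit slot `FinalTwoLegVolLimitEx` (Δ-VL1, plan g11 2026-08-26T23:34:46Z; `…VolumeLimitExDefs`, k3c5-p2) the
ASSEMBLY child holds for EVERY bundle and window: `twoPointAssemblyP3_existsThreshold` (`…TwoPointAssemblySlotThreshold`, k3c5-p2, on
r2d-p2's tower-free core `tendsto_hubbardThermalTwoPoint_of_finalTwoLegVolLimit`: Matsubara-UV identification at fixed `L` for every
coupling (t2), Gaussian change of covariance, source-shift representation, Riemann sums of the free part, dominated convergence over `k₀`
fed by the slot's own uniform bound), instantiated at `klPredsV12` as `twoPointAssemblyP3_klPredsV12_ex`.  The route declaration BY NAME; one line.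
-/

noncomputable section

namespace Summit.HubbardSuperconductivity.HubbardSuperconductivity.Theorems.TwoPointAssembly

set_option linter.dupNamespace false -- summit = problem name (single-conjunct summit), D-0017

/-- **Gen-4 child 4 of K3 holds**: `KLRegimeTwoPointAssemblyV12` (= `TwoPointAssemblyP3 klPredsV12 FinalTwoLegVolLimitEx klWindowC`), by
`KLRegimeSplit.twoPointAssemblyP3_klPredsV12_ex`. -/
theorem KLRegimeTwoPointAssemblyV12_of :
    Summit.HubbardSuperconductivity.HubbardSuperconductivity.Theses.KLProgramme.KLRegimeTwoPointAssemblyV12 :=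
  KLRegimeSplit.twoPointAssemblyP3_klPredsV12_ex

end Summit.HubbardSuperconductivity.HubbardSuperconductivity.Theorems.TwoPointAssembly

end
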